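import Summits.BirchSwinnertonDyer.Rank1Residual.X4.TwoPrimeSaturationOfMultiplicityOne
import Summits.BirchSwinnertonDyer.Rank1Residual.X4.LevelRaisingCongruenceIdealPair
import HarnessLib

/-!
# Proposition V58 in KERNEL FORM for the PAIR data of Prop. V64-D and in the modular-curve normalisation — the three `(𝒰, u)` dictionaries composed with step (i) (cell `b2b-bsdres`, seat additive-p4 gen 42, line V72/V73 — K123)

HONEST FRAMING (verbatim, cell `b2b-bsdres`): the goal of the cell is to DELETE the COMBINATION-SHAPED
residual classes for ALL analytic-rank `≤ 1` curves over `ℚ` — "full BSD formula for every rank `≤ 1`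
curve in class `C`" assembled STRICTLY from published theorems — so that the rank-`≤ 1` remainder
becomes exactly the CONSTRUCTION-SHAPED classes, which are TYPED (missing-input Props), NOT attempted;
this is not "finishing BSD". This file: PURE MODULE / MATRIX ALGEBRA over commutative rings (0 defs,
0 facts, nothing booked; X4 stays CONSTRUCTION-shaped; no mark moves).

## Why

`X4/TwoPrimeSaturationOfMultiplicityOne.lean` (K121) proves the V58 template as ONE implication
(`twoPrimeSaturated_of_brandtData'`) in the BRANDT normalisation `(𝒰_D, u_D)`:
`𝒰_D = !![0, −1; ℓ, T]`, Atkin–Lehner-twisted Gram matrix `u_D = !![T, ℓ+1; ℓ+1, T]`.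
`X4/LevelRaisingCongruenceIdealPair.lean` (K122) supplies Lemma L2 and the key identity (K^θ)
(`keyIdentity_of_pairData`) in the PAIR normalisation `(𝒰_D, u_A)` — Brandt basis with the UNTWISTED
Gram matrix `u_A = !![ℓ+1, T; T, ℓ+1]` of the duality pairing `S₀ × Q₀` of Prop. V64-D (ii‴)
(memo V64 §4.3) — and records that "the composition with K121's step (i) to 'T-V54 for `S₀`' is a
five-line corollary once both files are importable together". This file is that corollary, plus the
third dictionary, the MODULAR-CURVE normalisation `(𝒰_A, u_A)` with `𝒰_A = !![T, ℓ; −1, 0]`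
(K106 `oldSupported_action_mem_etaIdeal`), so that the kernel form of Prop. V58 is available in all
three `(𝒰, u)` normalisations that `X4/LevelRaisingCongruenceIdeal.lean` (K104) / K106 / K122 cover:

* `twoPrimeSaturated_of_pairData` — T-V54 in the multiplicity-one model `ι → T` from the PAIR data
  (hypotheses word for word those of `keyIdentity_of_pairData`, plus `η = U² − 1` kills the `ℓ₁`-new
  types `e₃, e₄` and `ker e₄` is `p`-saturated), through the commutative quotient `T ⧸ ker e₂`;
* `twoPrimeSaturated_of_pairData'` — the same with `hpoly` DISCHARGED (centralizer of `𝒰_D`, K121-3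
  `action_eq_smul_one_add_smul_companion`) and `hlift` REDUCED to `hscalar : R·1 ⊆ e₂(T)`;
* `exists_eq_smul_one_add_smul_of_commute_companionA` — the centralizer of `𝒰_A = !![T, ℓ; −1, 0]`
  in `M₂(R)` is `R·1 + R·𝒰_A` (read off from the second row);
* `keyIdentity_of_modularCurveData`, `twoPrimeSaturated_of_modularCurveData`,
  `twoPrimeSaturated_of_modularCurveData'` — (K) and T-V54 in the modular-curve normalisation.

No number theory enters. APPLICATION (sketch level, memo V64 §4.3 (ii‴), THETA-ROWS-ENDSTATE §2 (b)):
the `9`-new half T-V54(X²) of the θ-rows is transferred (JL + the depth-zero type `σ(θ) = Std(S₃)`) to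
the pair `(S₀, Q₀)` of `σ(θ)`-isotypic forms on the definite quaternion algebra; there `T` acts on
`H′ = S₀(M₀′ℓ₁)_𝔪`, the old plane is `S₀(M₀′)_𝔪² = Fin 2 → R` [(MO^θ): CERT E17b], `idag` is the
adjoint of the degeneracy map of the PARTNER module `Q₀` for the duality pairing (surjective = Ihara
for `σ(θ)`-forms in adjoint form), the Gram matrix is the untwisted `u_A` and `U_{ℓ₁}` acts on the
old θ-forms in the Brandt basis by `𝒰_D`. Which Gram matrix / basis a given application produces is an
input of the APPLICATION, not decided here; this file only guarantees that each of the three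
combinations in print leads to the same conclusion.

## References (context only)

* K. A. Ribet, Invent. Math. 100 (1990) 431–476, §3, Thm. 5.2. [cite: Ribet1990, §3, Thm. 5.2]
* A. Wiles, Ann. of Math. 141 (1995), Thm. 2.1. [cite: Wiles1995, Thm. 2.1]
* F. Diamond, "The refined conjecture of Serre" (Hong Kong 1993 volume), §§3–4. [cite: Diamond1995RefinedSerre, §§3–4]
-/

namespace Summit.BirchSwinnertonDyer.Rank1Residual.LevelLowering

open Matrix

/-! ## 1. The PAIR normalisation `(𝒰_D, u_A)`: Prop. V64-D (ii‴) in kernel form -/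

section PairKernelForm

variable {T R R₃ R₄ : Type*} [CommRing T] [CommRing R] [CommRing R₃] [CommRing R₄]
variable {H' : Type*} [AddCommGroup H']

/-- **PROPOSITION V58, KERNEL FORM, PAIR DATA** (memo V64 §4.3 (ii‴); K122-2 ∘ K121 step (i)). From
the pair data of `keyIdentity_of_pairData` (Gram matrix `u_A = !![ℓ+1, T; T, ℓ+1]`, `idag` surjective,
adjoint action = transpose, `ℓ₁`-old saturation `hW'`, `e₂(U_{ℓ₁}) = 𝒰_D = !![0, −1; ℓ, T]`,
`hpoly`/`hlift`), `η = U² − 1` killing the `ℓ₁`-new types `e₃, e₄`, and `ker e₄` `p`-saturated: in the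
multiplicity-one model `ι → T` the two-prime old lattice
`O₁ ⊔ O₂ = (ker e₃ ⊓ ker e₄)^ι ⊔ (ker e₂ ⊓ ker e₄)^ι` is `p`-SATURATED.
[cite: Ribet1990, §3, Thm. 5.2] [cite: Wiles1995, Thm. 2.1] [cite: Diamond1995RefinedSerre, §§3–4] -/
theorem twoPrimeSaturated_of_pairData {ι : Type*} (Tl ℓ : R)
    (e₂ : T →+* Matrix (Fin 2) (Fin 2) R) (e₃ : T →+* R₃) (e₄ : T →+* R₄) (p U : T)
    (hU : e₂ U = !![(0 : R), -1; ℓ, Tl])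
    (act : T → (H' →+ H')) (i : (Fin 2 → R) →+ H') (idag : H' →+ (Fin 2 → R))
    (hu : ∀ v, idag (i v) = (!![ℓ + 1, Tl; Tl, ℓ + 1] : Matrix (Fin 2) (Fin 2) R).mulVec v)
    (hsurj : Function.Surjective idag)
    (hadj : ∀ t h, idag (act t h) = (e₂ t).transpose.mulVec (idag h))
    (hW' : ∀ t, e₄ t = 0 → ∀ h, ∃ v, act t h = i v)
    (hpoly : ∀ t, ∃ a b : R, e₂ t = a • (1 : Matrix (Fin 2) (Fin 2) R) + b • !![(0 : R), -1; ℓ, Tl])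
    (hlift : ∀ c d : R, ∃ a : T,
      e₂ a = c • (1 : Matrix (Fin 2) (Fin 2) R) + d • !![(0 : R), -1; ℓ, Tl])
    (hη₃ : e₃ (U * U - 1) = 0) (hη₄ : e₄ (U * U - 1) = 0)
    (hsat₄ : ∀ t : T, p * t ∈ RingHom.ker e₄ → t ∈ RingHom.ker e₄) :
    ∀ x : ι → T,
        p • x ∈ Submodule.pi Set.univ
            (fun _ : ι => ((RingHom.ker e₃ ⊓ RingHom.ker e₄ : Ideal T) : Submodule T T)) ⊔
          Submodule.pi Set.univ
            (fun _ : ι => ((RingHom.ker e₂ ⊓ RingHom.ker e₄ : Ideal T) : Submodule T T)) →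
        x ∈ Submodule.pi Set.univ
            (fun _ : ι => ((RingHom.ker e₃ ⊓ RingHom.ker e₄ : Ideal T) : Submodule T T)) ⊔
          Submodule.pi Set.univ
            (fun _ : ι => ((RingHom.ker e₂ ⊓ RingHom.ker e₄ : Ideal T) : Submodule T T)) := by
  have hK := keyIdentity_of_pairData Tl ℓ e₂ e₄ U hU act i idag hu hsurj hadj hW' hpoly hlift
  -- pass to the commutative quotient `T ⧸ ker e₂`, which has the same kernel
  have hker : RingHom.ker (Ideal.Quotient.mk (RingHom.ker e₂)) = RingHom.ker e₂ := Ideal.mk_ker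
  have hη : U * U - 1 ∈ RingHom.ker e₃ ⊓ RingHom.ker e₄ :=
    ⟨by simpa [RingHom.mem_ker] using hη₃, by simpa [RingHom.mem_ker] using hη₄⟩
  have h := twoPrimeSaturated_of_levelRaising (ι := ι) (Ideal.Quotient.mk (RingHom.ker e₂)) e₃ e₄
    p (U * U - 1) hsat₄ hη (by rw [hker]; exact hK)
  rw [hker] at h
  exact h

/-- **PROPOSITION V58, KERNEL FORM, PAIR DATA — final displayed hypotheses**: as
`twoPrimeSaturated_of_pairData` with `hpoly` dropped (the centralizer of `𝒰_D` is `R·1 + R·𝒰_D` and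
`T` is commutative) and `hlift` replaced by `hscalar : R·1 ⊆ e₂(T)`. Displayed inputs: pair Gram
matrix `u_A`, `idag` surjective [Ihara for `σ(θ)`-forms, adjoint form], adjoint = transpose [duality
pairing `S₀ × Q₀`], `ℓ₁`-old saturation (`hW'`), `hscalar`, `η = U² − 1` kills the `ℓ₁`-new θ-forms,
`ker e₄` `p`-saturated; model: old plane `Fin 2 → R` [(MO^θ)], `H′ = ι → T` [(MO_X²)].
[cite: Ribet1990, §3, Thm. 5.2] [cite: Wiles1995, Thm. 2.1] [cite: Diamond1995RefinedSerre, §§3–4] -/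
theorem twoPrimeSaturated_of_pairData' {ι : Type*} (Tl ℓ : R)
    (e₂ : T →+* Matrix (Fin 2) (Fin 2) R) (e₃ : T →+* R₃) (e₄ : T →+* R₄) (p U : T)
    (hU : e₂ U = !![(0 : R), -1; ℓ, Tl])
    (act : T → (H' →+ H')) (i : (Fin 2 → R) →+ H') (idag : H' →+ (Fin 2 → R))
    (hu : ∀ v, idag (i v) = (!![ℓ + 1, Tl; Tl, ℓ + 1] : Matrix (Fin 2) (Fin 2) R).mulVec v)
    (hsurj : Function.Surjective idag)
    (hadj : ∀ t h, idag (act t h) = (e₂ t).transpose.mulVec (idag h))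
    (hW' : ∀ t, e₄ t = 0 → ∀ h, ∃ v, act t h = i v)
    (hscalar : ∀ c : R, ∃ a : T, e₂ a = c • (1 : Matrix (Fin 2) (Fin 2) R))
    (hη₃ : e₃ (U * U - 1) = 0) (hη₄ : e₄ (U * U - 1) = 0)
    (hsat₄ : ∀ t : T, p * t ∈ RingHom.ker e₄ → t ∈ RingHom.ker e₄) :
    ∀ x : ι → T,
        p • x ∈ Submodule.pi Set.univ
            (fun _ : ι => ((RingHom.ker e₃ ⊓ RingHom.ker e₄ : Ideal T) : Submodule T T)) ⊔
          Submodule.pi Set.univ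
            (fun _ : ι => ((RingHom.ker e₂ ⊓ RingHom.ker e₄ : Ideal T) : Submodule T T)) →
        x ∈ Submodule.pi Set.univ
            (fun _ : ι => ((RingHom.ker e₃ ⊓ RingHom.ker e₄ : Ideal T) : Submodule T T)) ⊔
          Submodule.pi Set.univ
            (fun _ : ι => ((RingHom.ker e₂ ⊓ RingHom.ker e₄ : Ideal T) : Submodule T T)) :=
  twoPrimeSaturated_of_pairData Tl ℓ e₂ e₃ e₄ p U hU act i idag hu hsurj hadj hW'
    (action_eq_smul_one_add_smul_companion Tl ℓ e₂ U hU)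
    (exists_action_eq_of_scalar_lift Tl ℓ e₂ U hU hscalar) hη₃ hη₄ hsat₄

end PairKernelForm

/-! ## 2. The MODULAR-CURVE normalisation `(𝒰_A, u_A)`, `𝒰_A = !![T, ℓ; −1, 0]` (K106 `oldSupported_action_mem_etaIdeal`) -/

section ModularCurveKernelForm

variable {T R R₃ R₄ : Type*} [CommRing T] [CommRing R] [CommRing R₃] [CommRing R₄]
variable {H' : Type*} [AddCommGroup H']

/-- **The centralizer of `𝒰_A = !![T, ℓ; −1, 0]` is `R[𝒰_A]`:** a `2 × 2` matrix commuting with `𝒰_A`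
is `a·1 + b·𝒰_A` (read off from its second row). [cite: Ribet1990, §3] -/
theorem exists_eq_smul_one_add_smul_of_commute_companionA (Tl ℓ : R)
    (A : Matrix (Fin 2) (Fin 2) R) (hA : A * !![Tl, ℓ; -1, 0] = !![Tl, ℓ; -1, 0] * A) :
    ∃ a b : R, A = a • (1 : Matrix (Fin 2) (Fin 2) R) + b • !![Tl, ℓ; -1, 0] := by
  have h10 := congrFun (congrFun hA 1) 0
  have h11 := congrFun (congrFun hA 1) 1
  simp [Matrix.mul_apply, Fin.sum_univ_two] at h10 h11
  refine ⟨A 1 1, -(A 1 0), ?_⟩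
  ext i j
  fin_cases i <;> fin_cases j <;> simp
  · linear_combination h10
  · linear_combination h11

/-- `hpoly` discharged in the modular-curve normalisation: for a ring homomorphism `e₂` out of a
COMMUTATIVE ring with `e₂ U = 𝒰_A`, every `e₂ t` lies in `R·1 + R·𝒰_A`. -/
theorem action_eq_smul_one_add_smul_companionA (Tl ℓ : R) (e₂ : T →+* Matrix (Fin 2) (Fin 2) R)
    (U : T) (hU : e₂ U = !![Tl, ℓ; -1, 0]) (t : T) :
    ∃ a b : R, e₂ t = a • (1 : Matrix (Fin 2) (Fin 2) R) + b • !![Tl, ℓ; -1, 0] := by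
  apply exists_eq_smul_one_add_smul_of_commute_companionA
  rw [← hU, ← map_mul, ← map_mul, mul_comm]

/-- `hlift` from scalars in the modular-curve normalisation: if `R·1 ⊆ e₂(T)` then
`R·1 + R·𝒰_A ⊆ e₂(T)`. -/
theorem exists_action_eq_of_scalar_liftA (Tl ℓ : R) (e₂ : T →+* Matrix (Fin 2) (Fin 2) R) (U : T)
    (hU : e₂ U = !![Tl, ℓ; -1, 0])
    (hscalar : ∀ c : R, ∃ a : T, e₂ a = c • (1 : Matrix (Fin 2) (Fin 2) R)) (c d : R) :
    ∃ a : T, e₂ a = c • (1 : Matrix (Fin 2) (Fin 2) R) + d • !![Tl, ℓ; -1, 0] := by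
  obtain ⟨a₁, ha₁⟩ := hscalar c
  obtain ⟨a₂, ha₂⟩ := hscalar d
  refine ⟨a₁ + a₂ * U, ?_⟩
  rw [map_add, map_mul, ha₁, ha₂, hU, smul_mul_assoc, one_mul]

/-- **The key identity (K) from the modular-curve data** (K106 `oldSupported_action_mem_etaIdeal` +
the lift): with Gram matrix `u_A = !![ℓ+1, T; T, ℓ+1]` and `e₂(U_{ℓ₁}) = 𝒰_A = !![T, ℓ; −1, 0]`, every
`t` with `e₄ t = 0` satisfies `t − (U² − 1)·a ∈ ker e₂` for some `a ∈ T`.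
[cite: Ribet1990, §3, Thm. 5.2] [cite: Diamond1995RefinedSerre, §§3–4] -/
theorem keyIdentity_of_modularCurveData (Tl ℓ : R) (e₂ : T →+* Matrix (Fin 2) (Fin 2) R)
    (e₄ : T →+* R₄) (U : T) (hU : e₂ U = !![Tl, ℓ; -1, 0])
    (act : T → (H' →+ H')) (i : (Fin 2 → R) →+ H') (idag : H' →+ (Fin 2 → R))
    (hu : ∀ v, idag (i v) = (!![ℓ + 1, Tl; Tl, ℓ + 1] : Matrix (Fin 2) (Fin 2) R).mulVec v)
    (hsurj : Function.Surjective idag)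
    (hadj : ∀ t h, idag (act t h) = (e₂ t).transpose.mulVec (idag h))
    (hW' : ∀ t, e₄ t = 0 → ∀ h, ∃ v, act t h = i v)
    (hpoly : ∀ t, ∃ a b : R, e₂ t = a • (1 : Matrix (Fin 2) (Fin 2) R) + b • !![Tl, ℓ; -1, 0])
    (hlift : ∀ c d : R, ∃ a : T,
      e₂ a = c • (1 : Matrix (Fin 2) (Fin 2) R) + d • !![Tl, ℓ; -1, 0]) :
    ∀ t ∈ RingHom.ker e₄, ∃ a : T, t - (U * U - 1) * a ∈ RingHom.ker e₂ := by
  intro t ht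
  rw [RingHom.mem_ker] at ht
  obtain ⟨a, b, hab⟩ := hpoly t
  have hact : ((e₂ t).transpose).transpose =
      a • (1 : Matrix (Fin 2) (Fin 2) R) + b • !![Tl, ℓ; -1, 0] := by
    rw [Matrix.transpose_transpose, hab]
  obtain ⟨c, d, hcd⟩ := oldSupported_action_mem_etaIdeal Tl ℓ a b i idag (act t)
    (e₂ t).transpose hu (hadj t) (hW' t ht) hsurj hact
  obtain ⟨a', ha'⟩ := hlift c d
  refine ⟨a', ?_⟩
  rw [RingHom.mem_ker, map_sub, hab, hcd, map_mul, ha', map_sub, map_one, map_mul, hU,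
    smul_one_add_smul_mul_sq_sub_one_comm, sub_self]

/-- **PROPOSITION V58, KERNEL FORM, MODULAR-CURVE NORMALISATION** (`𝒰_A = !![T, ℓ; −1, 0]`, untwisted
Gram matrix `u_A`): from the data of `keyIdentity_of_modularCurveData`, `η = U² − 1` killing `e₃, e₄`
and `ker e₄` `p`-saturated, the two-prime old lattice of the model `ι → T` is `p`-saturated.
[cite: Ribet1990, §3, Thm. 5.2] [cite: Wiles1995, Thm. 2.1] [cite: Diamond1995RefinedSerre, §§3–4] -/
theorem twoPrimeSaturated_of_modularCurveData {ι : Type*} (Tl ℓ : R)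
    (e₂ : T →+* Matrix (Fin 2) (Fin 2) R) (e₃ : T →+* R₃) (e₄ : T →+* R₄) (p U : T)
    (hU : e₂ U = !![Tl, ℓ; -1, 0])
    (act : T → (H' →+ H')) (i : (Fin 2 → R) →+ H') (idag : H' →+ (Fin 2 → R))
    (hu : ∀ v, idag (i v) = (!![ℓ + 1, Tl; Tl, ℓ + 1] : Matrix (Fin 2) (Fin 2) R).mulVec v)
    (hsurj : Function.Surjective idag)
    (hadj : ∀ t h, idag (act t h) = (e₂ t).transpose.mulVec (idag h))
    (hW' : ∀ t, e₄ t = 0 → ∀ h, ∃ v, act t h = i v)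
    (hpoly : ∀ t, ∃ a b : R, e₂ t = a • (1 : Matrix (Fin 2) (Fin 2) R) + b • !![Tl, ℓ; -1, 0])
    (hlift : ∀ c d : R, ∃ a : T,
      e₂ a = c • (1 : Matrix (Fin 2) (Fin 2) R) + d • !![Tl, ℓ; -1, 0])
    (hη₃ : e₃ (U * U - 1) = 0) (hη₄ : e₄ (U * U - 1) = 0)
    (hsat₄ : ∀ t : T, p * t ∈ RingHom.ker e₄ → t ∈ RingHom.ker e₄) :
    ∀ x : ι → T,
        p • x ∈ Submodule.pi Set.univ
            (fun _ : ι => ((RingHom.ker e₃ ⊓ RingHom.ker e₄ : Ideal T) : Submodule T T)) ⊔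
          Submodule.pi Set.univ
            (fun _ : ι => ((RingHom.ker e₂ ⊓ RingHom.ker e₄ : Ideal T) : Submodule T T)) →
        x ∈ Submodule.pi Set.univ
            (fun _ : ι => ((RingHom.ker e₃ ⊓ RingHom.ker e₄ : Ideal T) : Submodule T T)) ⊔
          Submodule.pi Set.univ
            (fun _ : ι => ((RingHom.ker e₂ ⊓ RingHom.ker e₄ : Ideal T) : Submodule T T)) := by
  have hK := keyIdentity_of_modularCurveData Tl ℓ e₂ e₄ U hU act i idag hu hsurj hadj hW' hpoly
    hlift
  have hker : RingHom.ker (Ideal.Quotient.mk (RingHom.ker e₂)) = RingHom.ker e₂ := Ideal.mk_ker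
  have hη : U * U - 1 ∈ RingHom.ker e₃ ⊓ RingHom.ker e₄ :=
    ⟨by simpa [RingHom.mem_ker] using hη₃, by simpa [RingHom.mem_ker] using hη₄⟩
  have h := twoPrimeSaturated_of_levelRaising (ι := ι) (Ideal.Quotient.mk (RingHom.ker e₂)) e₃ e₄
    p (U * U - 1) hsat₄ hη (by rw [hker]; exact hK)
  rw [hker] at h
  exact h

/-- **PROPOSITION V58, KERNEL FORM, MODULAR-CURVE NORMALISATION — final displayed hypotheses**
(`hpoly` dropped, `hlift` replaced by `hscalar : R·1 ⊆ e₂(T)`).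
[cite: Ribet1990, §3, Thm. 5.2] [cite: Wiles1995, Thm. 2.1] [cite: Diamond1995RefinedSerre, §§3–4] -/
theorem twoPrimeSaturated_of_modularCurveData' {ι : Type*} (Tl ℓ : R)
    (e₂ : T →+* Matrix (Fin 2) (Fin 2) R) (e₃ : T →+* R₃) (e₄ : T →+* R₄) (p U : T)
    (hU : e₂ U = !![Tl, ℓ; -1, 0])
    (act : T → (H' →+ H')) (i : (Fin 2 → R) →+ H') (idag : H' →+ (Fin 2 → R))
    (hu : ∀ v, idag (i v) = (!![ℓ + 1, Tl; Tl, ℓ + 1] : Matrix (Fin 2) (Fin 2) R).mulVec v)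
    (hsurj : Function.Surjective idag)
    (hadj : ∀ t h, idag (act t h) = (e₂ t).transpose.mulVec (idag h))
    (hW' : ∀ t, e₄ t = 0 → ∀ h, ∃ v, act t h = i v)
    (hscalar : ∀ c : R, ∃ a : T, e₂ a = c • (1 : Matrix (Fin 2) (Fin 2) R))
    (hη₃ : e₃ (U * U - 1) = 0) (hη₄ : e₄ (U * U - 1) = 0)
    (hsat₄ : ∀ t : T, p * t ∈ RingHom.ker e₄ → t ∈ RingHom.ker e₄) :
    ∀ x : ι → T,
        p • x ∈ Submodule.pi Set.univ
            (fun _ : ι => ((RingHom.ker e₃ ⊓ RingHom.ker e₄ : Ideal T) : Submodule T T)) ⊔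
          Submodule.pi Set.univ
            (fun _ : ι => ((RingHom.ker e₂ ⊓ RingHom.ker e₄ : Ideal T) : Submodule T T)) →
        x ∈ Submodule.pi Set.univ
            (fun _ : ι => ((RingHom.ker e₃ ⊓ RingHom.ker e₄ : Ideal T) : Submodule T T)) ⊔
          Submodule.pi Set.univ
            (fun _ : ι => ((RingHom.ker e₂ ⊓ RingHom.ker e₄ : Ideal T) : Submodule T T)) :=
  twoPrimeSaturated_of_modularCurveData Tl ℓ e₂ e₃ e₄ p U hU act i idag hu hsurj hadj hW'
    (action_eq_smul_one_add_smul_companionA Tl ℓ e₂ U hU)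
    (exists_action_eq_of_scalar_liftA Tl ℓ e₂ U hU hscalar) hη₃ hη₄ hsat₄

end ModularCurveKernelForm

end Summit.BirchSwinnertonDyer.Rank1Residual.LevelLowering
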